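import Summits.QuantumFields.BalabanUV.Beta.GAN24.SymContactFaceJumpCommutator

/-!
# `BalabanUV.Beta.GAN24.SymContactLambdaCellBound` — binder row G-an2-4 ∕ (CONV-C), TRANSFER-III, the (III′) S-slot (b) of the END, born-Λ contact letter `hCg` (road-P2 M.104's
# 3rd hypothesis), TABLE HALF («mksym lane»), PART 4: **THE TWO COMMUTATOR LETTERS IN ENVELOPE FORM AT an1's (0.4)-SYMMETRISED ROOTED AVERAGING** — the twin of leaf-02 g49's
# `ContactLambdaCellBound` §3 (`abs_commutator_le_of_staircase_of_env`, `abs_commutator_dz_le_of_staircase_of_env`) with `linAvgAt ↦ symLinAvgAt`, `linCountAt ↦ symLinCountAt`, over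
# MY PART 2 `SymContactFaceJumpCommutator` BY NAME; leaf-02's §1∕§2∕§4 (`abs_sum_tsum_le`, the norm letters, `abs_sum_tsum_mul_le_of_env3`) are table-free and are consumed BY NAME downstream
# (G-an2-4 CRUX TEAM (2), leaf prover `b2b-balaban-gan24-formalise-leaf-01`, gen 90)

NOT IN PRINT; OUR BOOKKEEPING ([folklore]; 0 `def`, 0 cited fact, 0 `def … : Prop`, 0 sorry).  HONEST FRAMING (cell contract, verbatim): «discharging `BetaPertH` makes
Bałaban's UV stability UNCONDITIONAL — a real constructive-QFT result; it is NOT the continuum limit and NOT the Clay problem.»  HONEST DEPENDENCY (verbatim): «continuum YM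
on T⁴ ⇐ BetaPertH ∧ nine spine estimates (0/9 proved); BetaPertH ⇐ (D1) ∧ (D4) ∧ CAP+tail; G-an2-4 gates asym, D1 and NE2/3/4.»  Discharges NO letter of M.104 by itself;
NEVER «G-an2-4 closed» as (CONV-C); NOT D1, NOT `BetaPertH`, NOT continuum, NOT Clay.  2026-08-28; no existing file touched.
-/

noncomputable section

open Finset
open scoped BigOperators
open Literature.MathematicalPhysics.QuantumFieldTheory
open Literature.MathematicalPhysics.QuantumFieldTheory.Balaban1983to89
open Literature.MathematicalPhysics.QuantumFieldTheory.Balaban1983to89.Beta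
open AffineAveraging (Form0 Form1 Site box toSite unitVec dz)
open AveragingContours (blk)
open Summit.QuantumFields.BalabanUV.Beta.SymmetrisedAxialPotential (symLinAvgAt)
open Summit.QuantumFields.BalabanUV.Beta.SymAveragingHessianCounts (symLinCountAt)
open Summit.QuantumFields.BalabanUV.Beta.LinearGaugeVH (nearBox mem_nearBox)

namespace Summit.QuantumFields.BalabanUV.Beta.GAN24.SymContactLambdaCellBound

variable {d : ℕ}

/-! ## §3 The commutator letters in envelope form -/

section Commutator

variable {Lc : ℕ} {rr : Fin (d + 1) → ℕ}

/-- NOT IN PRINT; OUR BOOKKEEPING ([folklore] over MY `SymContactFaceJumpCommutator` §3).  **THE MIXED COMMUTATOR LETTER, ENVELOPE FORM**: for a staircase `ψ = Σ_{s<n+1} G s ∘ blk (Lc^s)`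
whose finest-piece four-site weight is `≤ W₀·E` on the support box and whose face jumps across the bond `(μ,y)` sum to `≤ F·E` (ONE envelope value `E ≥ 0` for the bond),
a leg `|B α x| ≤ M` on the support box and a count `Σ_x Σ_α |symLinCountAt| ≤ Cnt`:
`|[𝒬^ρ_{Lc,sym}, ψ̄]B (μ,y)|` ≤ (W₀ + F)·(E·M·Cnt)`. -/
theorem abs_commutator_le_of_staircase_of_env (hLc : 1 ≤ Lc) (hrr : rr ∈ box (d + 1) Lc) (G : ℕ → Site (d + 1) → ℝ) (n : ℕ)
    {ψ : Site (d + 1) → ℝ} (hψ : ∀ u, ψ u = ∑ s ∈ Finset.range (n + 1), G s (blk (Lc ^ s) u)) (B : Form1 (d + 1) ℝ) (μ : Fin (d + 1)) (y : Site (d + 1))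
    {W₀ F E M Cnt : ℝ} (hW₀ : 0 ≤ W₀) (hE : 0 ≤ E) (hM : 0 ≤ M)
    (hW : ∀ α, ∀ x ∈ nearBox Lc y, |G 0 x + G 0 (x + unitVec α) - G 0 ((Lc : ℤ) • y + toSite rr) - G 0 ((Lc : ℤ) • y + toSite rr + (Lc : ℤ) • unitVec μ)| ≤ W₀ * E)
    (hJ : ∑ s ∈ Finset.range n, |G (s + 1) (blk (Lc ^ s) (y + unitVec μ)) - G (s + 1) (blk (Lc ^ s) y)| ≤ F * E)
    (hB : ∀ α, ∀ x ∈ nearBox Lc y, |B α x| ≤ M)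
    (hCnt : ∑ x ∈ nearBox Lc y, ∑ α, |(symLinCountAt (toSite rr) Lc μ y (α, x) : ℝ)| ≤ Cnt) :
    |symLinAvgAt (toSite rr) (fun α x => (ψ x + ψ (x + unitVec α)) * B α x) Lc μ y
        - (ψ ((Lc : ℤ) • y + toSite rr) + ψ ((Lc : ℤ) • y + toSite rr + (Lc : ℤ) • unitVec μ)) * symLinAvgAt (toSite rr) B Lc μ y|
      ≤ (W₀ + F) * (E * M * Cnt) := by
  have h := SymContactFaceJumpCommutator.abs_commutator_le_of_staircase_of_le hLc hrr G n hψ B μ y hW hB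
  have hJ0 : 0 ≤ ∑ s ∈ Finset.range n, |G (s + 1) (blk (Lc ^ s) (y + unitVec μ)) - G (s + 1) (blk (Lc ^ s) y)| :=
    Finset.sum_nonneg fun _ _ => abs_nonneg _
  have hc0 : 0 ≤ ∑ x ∈ nearBox Lc y, ∑ α, |(symLinCountAt (toSite rr) Lc μ y (α, x) : ℝ)| :=
    Finset.sum_nonneg fun _ _ => Finset.sum_nonneg fun _ _ => abs_nonneg _
  have hWE : 0 ≤ W₀ * E := mul_nonneg hW₀ hE
  refine h.trans ?_
  calc (W₀ * E + ∑ s ∈ Finset.range n, |G (s + 1) (blk (Lc ^ s) (y + unitVec μ)) - G (s + 1) (blk (Lc ^ s) y)|) * M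
          * ∑ x ∈ nearBox Lc y, ∑ α, |(symLinCountAt (toSite rr) Lc μ y (α, x) : ℝ)|
        ≤ (W₀ * E + F * E) * M * Cnt := by
          have h1 : (W₀ * E + ∑ s ∈ Finset.range n, |G (s + 1) (blk (Lc ^ s) (y + unitVec μ)) - G (s + 1) (blk (Lc ^ s) y)|) * M
              ≤ (W₀ * E + F * E) * M := mul_le_mul_of_nonneg_right (by linarith) hM
          exact mul_le_mul h1 hCnt hc0 (mul_nonneg (by linarith) hM)
    _ = (W₀ + F) * (E * M * Cnt) := by ring

/-- NOT IN PRINT; OUR BOOKKEEPING ([folklore] over MY `SymContactFaceJumpCommutator` §4).  **THE ΔΔ COMMUTATOR LETTER, ENVELOPE FORM** (two staircases `ψ_a`, `ψ_b` of the same depth with a COMMON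
jump letter `F` — the route's two bond gauge functions of one lineage): finest-piece weight of `ψ_a` `≤ W_a·E_a`, finest-piece gradient of `ψ_b` `≤ g_b·E_b` on the support box, jump sums
`J_a ≤ F·E_a`, `J_b ≤ F·E_b` (`E_a, E_b ≥ 0`), count `≤ Cnt`:
`|[𝒬^ρ_{Lc,sym}, ψ̄_a](dz ψ_b)(μ,y)|` ≤ (W_a·g_b + (W_a + g_b)·F)·(E_a·E_b·Cnt)` — the two coarse jump sums never multiply (the owner's §0′). -/
theorem abs_commutator_dz_le_of_staircase_of_env (hLc : 1 ≤ Lc) (hrr : rr ∈ box (d + 1) Lc) (Ga Gb : ℕ → Site (d + 1) → ℝ) (n : ℕ)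
    {ψa ψb : Site (d + 1) → ℝ} (hψa : ∀ u, ψa u = ∑ s ∈ Finset.range (n + 1), Ga s (blk (Lc ^ s) u))
    (hψb : ∀ u, ψb u = ∑ s ∈ Finset.range (n + 1), Gb s (blk (Lc ^ s) u)) (μ : Fin (d + 1)) (y : Site (d + 1))
    {Wa gb F Ea Eb Cnt : ℝ} (hWa0 : 0 ≤ Wa) (hgb0 : 0 ≤ gb) (hEa : 0 ≤ Ea) (hEb : 0 ≤ Eb)
    (hWa : ∀ α, ∀ x ∈ nearBox Lc y, |Ga 0 x + Ga 0 (x + unitVec α) - Ga 0 ((Lc : ℤ) • y + toSite rr) - Ga 0 ((Lc : ℤ) • y + toSite rr + (Lc : ℤ) • unitVec μ)| ≤ Wa * Ea)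
    (hgb : ∀ α, ∀ x ∈ nearBox Lc y, |dz (Gb 0) α x| ≤ gb * Eb)
    (hJa : ∑ s ∈ Finset.range n, |Ga (s + 1) (blk (Lc ^ s) (y + unitVec μ)) - Ga (s + 1) (blk (Lc ^ s) y)| ≤ F * Ea)
    (hJb : ∑ s ∈ Finset.range n, |Gb (s + 1) (blk (Lc ^ s) (y + unitVec μ)) - Gb (s + 1) (blk (Lc ^ s) y)| ≤ F * Eb)
    (hCnt : ∑ x ∈ nearBox Lc y, ∑ α, |(symLinCountAt (toSite rr) Lc μ y (α, x) : ℝ)| ≤ Cnt) :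
    |symLinAvgAt (toSite rr) (fun α x => (ψa x + ψa (x + unitVec α)) * dz ψb α x) Lc μ y
        - (ψa ((Lc : ℤ) • y + toSite rr) + ψa ((Lc : ℤ) • y + toSite rr + (Lc : ℤ) • unitVec μ)) * symLinAvgAt (toSite rr) (dz ψb) Lc μ y|
      ≤ (Wa * gb + (Wa + gb) * F) * (Ea * Eb * Cnt) := by
  have h := SymContactFaceJumpCommutator.abs_commutator_dz_le_of_staircase_of_le hLc hrr Ga Gb n n hψa hψb μ y (mul_nonneg hWa0 hEa) hWa hgb
  set Ja : ℝ := ∑ s ∈ Finset.range n, |Ga (s + 1) (blk (Lc ^ s) (y + unitVec μ)) - Ga (s + 1) (blk (Lc ^ s) y)| with hJadef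
  set Jb : ℝ := ∑ s ∈ Finset.range n, |Gb (s + 1) (blk (Lc ^ s) (y + unitVec μ)) - Gb (s + 1) (blk (Lc ^ s) y)| with hJbdef
  have hJa0 : 0 ≤ Ja := Finset.sum_nonneg fun _ _ => abs_nonneg _
  have hJb0 : 0 ≤ Jb := Finset.sum_nonneg fun _ _ => abs_nonneg _
  have hc0 : 0 ≤ ∑ x ∈ nearBox Lc y, ∑ α, |(symLinCountAt (toSite rr) Lc μ y (α, x) : ℝ)| :=
    Finset.sum_nonneg fun _ _ => Finset.sum_nonneg fun _ _ => abs_nonneg _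
  refine h.trans ?_
  have hpre : Wa * Ea * (gb * Eb + Jb) + Ja * (gb * Eb) ≤ (Wa * gb + (Wa + gb) * F) * (Ea * Eb) := by
    have h1 : Wa * Ea * Jb ≤ Wa * Ea * (F * Eb) := mul_le_mul_of_nonneg_left hJb (mul_nonneg hWa0 hEa)
    have h2 : Ja * (gb * Eb) ≤ (F * Ea) * (gb * Eb) := mul_le_mul_of_nonneg_right hJa (mul_nonneg hgb0 hEb)
    nlinarith
  have hpre0 : 0 ≤ Wa * Ea * (gb * Eb + Jb) + Ja * (gb * Eb) := by positivity
  calc (Wa * Ea * (gb * Eb + Jb) + Ja * (gb * Eb)) * ∑ x ∈ nearBox Lc y, ∑ α, |(symLinCountAt (toSite rr) Lc μ y (α, x) : ℝ)|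
      ≤ ((Wa * gb + (Wa + gb) * F) * (Ea * Eb)) * Cnt := mul_le_mul hpre hCnt hc0 (hpre0.trans hpre)
    _ = (Wa * gb + (Wa + gb) * F) * (Ea * Eb * Cnt) := by ring

end Commutator

end Summit.QuantumFields.BalabanUV.Beta.GAN24.SymContactLambdaCellBound

end
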